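import Summits.BirchSwinnertonDyer.BirchSwinnertonDyer.Theorems.ByReductionTypeAtTwoRankOneAtTwoBigImageOddLocalOneDoorSubsliceDescentBits
import Summits.BirchSwinnertonDyer.BirchSwinnertonDyer.Theorems.ByReductionTypeAtTwoRankOneAtTwoBigImageOddLocalOneDoorSubslicePosDisc
import Summits.BirchSwinnertonDyer.BirchSwinnertonDyer.Theorems.ByReductionTypeAtTwoRankOneAtTwoBigImageOddLocalOneDoorSubsliceNegDisc
import Summits.BirchSwinnertonDyer.Rank1Residual.F1Sign2.RegularKolyvaginPrimesAtTwo
import HarnessLib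

/-!
# Route ByReductionTypeAtTwo, crux `RankOneAtTwoBigImageOddLocal` (stmt-BirchSwinnertonDyer-23715), line `one_door_analytic`:
# ES-18a U₀⁺ `HeegnerCornerPosDiscAtTwo` IN ITS OWN (SELMER) CURRENCY ON THE 23715 SLICE, modulo five printed facts

Lead prover seat `bsd-line-fkl-p1` g19 (2026-08-29).  THEOREMS ONLY (standard axioms; no `def`, no named fact, no `sorry`).  CONDITIONAL by design
on the five printed facts of the bottom rung U₀ (Gross–Zagier 1986, Kolyvagin 1990, modularity as a newform, Hoffstein–Luo 1997, Gross 1991 Prop. 3.7 (2)),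
taken as hypotheses.  Helper file `--supports stmt-BirchSwinnertonDyer-23715`; it does not close the crux and BSD is not proved by any of this.

-es g9's U₀⁺ `RegularKolyvagin.HeegnerCornerPosDiscAtTwo` (ES-18a, `F1Sign2/RegularKolyvaginPrimesAtTwo.lean`; REF1 §112 «THEOREM-CANDIDATE beyond print»;
REF2 v30 §5 «NOT IN PRINT … beyond-print NOT YET (sketch ≠ kernel) — YES-small once kernel»; census ENGINE S 427/427) says, in SELMER currency: `Δ_W > 0`,
`ρ̄_{W,2}` onto, analytic rank `1`, `∏ c_ℓ` odd, `K` imaginary quadratic with DESC-admissible `d_K`, `P` the Heegner point of an odd-constant datum,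
`P ∉ 2E(K) + E(K)_tors` ⟹ `#Sel₂(W/ℚ) = 2 ∧ #Sel₂(W^{(d_K)}/ℚ) = 1`.  The line of record's bottom rung U₀ (`DoorIndexLawUpperCAtTwoBottom`, both signs,
door currency) has been a kernel theorem modulo the five printed facts since v8.13 (`doorIndexLawUpperCAtTwoBottom_of_print_ctFree`, width seat fkl-p2 g12),
and fkl-p2 g13/g14's `…OneDoorSubsliceDescentBits.lean` reads the same frame in Selmer currency AT A BOTTOM-RUNG DATUM
(`natCard_selmerGroup_at_bottomRung_of_print`, `twistSelmerTwoCard_eq_one_at_bottomRung_of_print`).  This file assembles ES-18a's EXACT conclusion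
ON THE 23715 SLICE (ES-18a's hypotheses plus the slice's `¬ CM`, `ρ_{W,2^n}` onto for all `n`, odd torsion order) from those: a desc-admissible `d_K`
at `Δ_W > 0` is a MINIMAL admissible door (`ANg16.doorAdmissible_of_descAdmissible`, `minimal_of_descAdmissible_of_pos`), `P ∉ 2E(K) + E(K)_tors` is
exponent `0` (`hasTwoDivisibilityUpToTorsion_zero_of_notTwiceUpToTorsion`) and opens the door by Gross–Zagier
(`twist_entireLFunction_ne_zero_of_hasTwoDivisibilityUpToTorsion_zero`, no `2`-converse), a globally minimal model of the twist exists
(`hasGlobalMinimalModel_rat_holds`), and the bottom-rung readout applies.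

* `heegnerCornerPosDiscAtTwo_slice_of_print` — ES-18a's conclusion on the slice, modulo the five printed facts;
* `heegnerCornerPosDiscAtTwo_slice_of_print'` — the same with ES-18a's literal `¬ 2 ∣ W.tamagawaProduct` binder.
What is NOT proved: ES-18a AS TYPED (it assumes only `ρ̄_{W,2}` onto — no `¬ CM`, no `2`-adic tower surjectivity, no odd torsion order); the gap
is exactly the habitat of route GenusKolyvaginAtTwo's item 24880 `KolyvaginRelationAtTwo` through which the first-layer classes are supplied.
-/

set_option autoImplicit false
set_option linter.dupNamespace false

noncomputable section

open scoped Classical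

namespace Summit.BirchSwinnertonDyer.BirchSwinnertonDyer.Theorems.RankOneAtTwoOneDoor

open WeierstrassCurve NumberField
open Literature.NumberTheory.EllipticCurves Literature.NumberTheory.EllipticCurves.ModularForms
open Summit.BirchSwinnertonDyer.Rank1Residual.F1Sign2
open Summit.BirchSwinnertonDyer.Rank1Residual.F1Sign2.RegularKolyvagin

/-- **ES-18a U₀⁺ ON THE 23715 SLICE, modulo five printed facts.**  For `W/ℚ` globally minimal elliptic with `Δ_W > 0`, non-CM, `ρ_{W,2^n}` onto for
all `n`, odd torsion order, odd Tamagawa product, analytic rank `1`; `K` imaginary quadratic with desc-admissible `d_K`; `P ∈ E(K)` the Heegner point of a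
parametrisation datum with odd constant: IF `P ∉ 2E(K) + E(K)_tors` THEN `#Sel₂(W/ℚ) = 2` and `#Sel₂(W^{(d_K)}/ℚ) = 1`.  Hypotheses `hGZ`, `hKo`, `hnf`,
`hHL`, `h37` = Gross–Zagier, Kolyvagin, modularity, Hoffstein–Luo, Gross 1991 Prop. 3.7 (2) (tree named facts).  Kolyvagin's first `2`-descent over `ℚ` at
the minimal `Δ_W > 0` door with error place `∞` (the line's U₀ engine), read in Selmer currency.
[cite: GrossLMS1991, Props. 3.7, 6.2 and §10] [cite: Kolyvagin1990, Thm. A] [cite: Kramer1981, Prop. 6] [cite: MazurRubin2010, Cor. 3.4 (i)] -/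
theorem heegnerCornerPosDiscAtTwo_slice_of_print
    (hGZ : ∀ (N : ℕ) [NeZero N] (W : WeierstrassCurve ℚ) (K : Type) [Field K] [NumberField K], gross_zagier N W K)
    (hKo : ∀ (N : ℕ) [NeZero N] (W : WeierstrassCurve ℚ) (K : Type) [Field K] [NumberField K], kolyvagin N W K)
    (hnf : exists_isNewformOf) (hHL : HoffsteinLuo1997_exists_twist_L_one_ne_zero)
    (h37 : Literature.NumberTheory.EllipticCurves.GrossLMS1991.prop37_2_frobeniusCongruence) :
    ∀ (W : WeierstrassCurve ℚ) [W.IsElliptic] [W.IsGloballyMinimal] [NeZero (W.conductorNorm ℤ)],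
    0 < W.Δ → ¬ W.HasCM → (∀ n : ℕ, W.HasSurjectiveModNGaloisRep ((2 ^ n : ℕ) : ℤ)) → Odd W.torsionOrder → Odd W.tamagawaProduct →
    W.analyticRank = 1 →
    ∀ (K : Type) [Field K] [NumberField K], IsImaginaryQuadratic K → DescAdmissible W (NumberField.discr K) →
      ∀ (Dt : ModularParametrizationData W (W.conductorNorm ℤ))
        (H : HeegnerDatum (W.conductorNorm ℤ) (NumberField.discr K)) (ι : K →+* ℂ)
        (P : (W.baseChange K).toAffine.Point),
        WeierstrassCurve.Affine.Point.map ι.toRatAlgHom P = heegnerPointComplex Dt H →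
        ¬ (2 : ℤ) ∣ Dt.c →
        NotTwiceUpToTorsion W K P →
          selmerTwoCard W = 2 ∧ twistSelmerTwoCard W (NumberField.discr K) = 1 := by
  intro W _ _ _ hΔ hCM hsurj hT hc hr K _ _ hK hDA Dt H ι P hP hc2 hnt
  have hadm : DoorAdmissible W (NumberField.discr K) := ANg16.doorAdmissible_of_descAdmissible W hDA
  have hmin : transpCount W (NumberField.discr K) + 2 * identCount W (NumberField.discr K) = (if W.Δ < 0 then 1 else 0) :=
    minimal_of_descAdmissible_of_pos W hΔ hDA
  have hm0 : HasTwoDivisibilityUpToTorsion W K P 0 := hasTwoDivisibilityUpToTorsion_zero_of_notTwiceUpToTorsion W K P hnt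
  have hHN : SatisfiesHeegnerHypothesis (W.conductorNorm ℤ) K := satisfiesHeegnerHypothesis_of_doorAdmissible W K hK hadm
  have hLt : (W.quadraticTwist (NumberField.discr K : ℚ)).entireLFunction 1 ≠ 0 :=
    twist_entireLFunction_ne_zero_of_hasTwoDivisibilityUpToTorsion_zero hnf W hr K hK (hGZ _ W K) hHN Dt H ι P hP hm0
  have hodd : Odd Dt.c := Int.not_even_iff_odd.mp fun h => hc2 (even_iff_two_dvd.mp h)
  -- a globally minimal model of the twist
  have hd0 : (NumberField.discr K : ℚ) ≠ 0 := by exact_mod_cast hK.discr_neg.ne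
  haveI := W.isElliptic_quadraticTwist hd0
  obtain ⟨Cd, hCd⟩ := hasGlobalMinimalModel_rat_holds (W.quadraticTwist (NumberField.discr K : ℚ))
  haveI := hCd
  have h1 := natCard_selmerGroup_at_bottomRung_of_print hGZ hKo hnf hHL h37 W hCM hsurj hT hc hr K hK hadm hLt Dt H ι P hP
    (Cd • W.quadraticTwist (NumberField.discr K : ℚ)) Cd rfl hmin hodd hm0
  have h2 := twistSelmerTwoCard_eq_one_at_bottomRung_of_print hGZ hKo hnf hHL h37 W hCM hsurj hT hc hr K hK hadm hLt Dt H ι P hP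
    (Cd • W.quadraticTwist (NumberField.discr K : ℚ)) Cd rfl hmin hodd hm0
  exact ⟨h1.1, h2⟩

/-- **The same with ES-18a's literal Tamagawa binder `¬ 2 ∣ W.tamagawaProduct`** (in place of the slice's `Odd W.tamagawaProduct`). -/
theorem heegnerCornerPosDiscAtTwo_slice_of_print'
    (hGZ : ∀ (N : ℕ) [NeZero N] (W : WeierstrassCurve ℚ) (K : Type) [Field K] [NumberField K], gross_zagier N W K)
    (hKo : ∀ (N : ℕ) [NeZero N] (W : WeierstrassCurve ℚ) (K : Type) [Field K] [NumberField K], kolyvagin N W K)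
    (hnf : exists_isNewformOf) (hHL : HoffsteinLuo1997_exists_twist_L_one_ne_zero)
    (h37 : Literature.NumberTheory.EllipticCurves.GrossLMS1991.prop37_2_frobeniusCongruence) :
    ∀ (W : WeierstrassCurve ℚ) [W.IsElliptic] [W.IsGloballyMinimal] [NeZero (W.conductorNorm ℤ)],
    0 < W.Δ → ¬ W.HasCM → (∀ n : ℕ, W.HasSurjectiveModNGaloisRep ((2 ^ n : ℕ) : ℤ)) → Odd W.torsionOrder → ¬ 2 ∣ W.tamagawaProduct →
    W.analyticRank = 1 →
    ∀ (K : Type) [Field K] [NumberField K], IsImaginaryQuadratic K → DescAdmissible W (NumberField.discr K) →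
      ∀ (Dt : ModularParametrizationData W (W.conductorNorm ℤ))
        (H : HeegnerDatum (W.conductorNorm ℤ) (NumberField.discr K)) (ι : K →+* ℂ)
        (P : (W.baseChange K).toAffine.Point),
        WeierstrassCurve.Affine.Point.map ι.toRatAlgHom P = heegnerPointComplex Dt H →
        ¬ (2 : ℤ) ∣ Dt.c →
        NotTwiceUpToTorsion W K P →
          selmerTwoCard W = 2 ∧ twistSelmerTwoCard W (NumberField.discr K) = 1 := by
  intro W _ _ _ hΔ hCM hsurj hT hc hr K _ _ hK hDA Dt H ι P hP hc2 hnt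
  exact heegnerCornerPosDiscAtTwo_slice_of_print hGZ hKo hnf hHL h37 W hΔ hCM hsurj hT (Nat.odd_iff.mpr (Nat.two_dvd_ne_zero.mp hc)) hr
    K hK hDA Dt H ι P hP hc2 hnt

/-! ### APPEND #1 (lead `bsd-line-fkl-p1` g19, 2026-08-29T03:4xZ) — ES-18b R18-ID `IdentityComponentEvenIndexAtTwo` ON THE SLICE, modulo print

-es g9's companion row R18-ID (`RegularKolyvagin.IdentityComponentEvenIndexAtTwo`, «THEOREM-CANDIDATE; the Ш-free shadow of U₀⁺»; census ENGINE S 48/48):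
same curve and field hypotheses as ES-18a; if `E(ℚ) ⊂ E⁰(ℝ)` (`¬ MeetsEgg W`) then the Heegner point of every desc-admissible `K` (odd-constant datum)
lies in `2E(K) + E(K)_tors`.  On the 23715 slice this is the contrapositive of the width seat's `meetsEgg_at_bottomRung_of_print` (at a bottom-rung
datum with `Δ_W > 0`, `E(ℚ)` meets the egg: route GenusKolyvaginAtTwo's THEOREM `eggTwistLawAtTwo_holds`, Kramer Prop. 6, against the twin's
`#Sel₂(W^{(d_K)}) = 1`), assembled exactly as ES-18a above. -/

/-- **ES-18b R18-ID ON THE 23715 SLICE, modulo five printed facts.**  For `W/ℚ` globally minimal elliptic with `Δ_W > 0`, non-CM, `ρ_{W,2^n}` onto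
for all `n`, odd torsion order, odd Tamagawa product, analytic rank `1` and NO rational point on the egg; `K` imaginary quadratic with desc-admissible
`d_K`; `P ∈ E(K)` the Heegner point of a parametrisation datum with odd constant: `P ∈ 2E(K) + E(K)_tors` (`¬ NotTwiceUpToTorsion W K P`, i.e. `m ≥ 1`).
[cite: Kramer1981, Prop. 6] [cite: GrossLMS1991, Props. 3.7, 6.2 and §10] [cite: MazurRubin2010, Prop. 3.3 and Cor. 3.4 (i)] -/
theorem identityComponentEvenIndexAtTwo_slice_of_print
    (hGZ : ∀ (N : ℕ) [NeZero N] (W : WeierstrassCurve ℚ) (K : Type) [Field K] [NumberField K], gross_zagier N W K)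
    (hKo : ∀ (N : ℕ) [NeZero N] (W : WeierstrassCurve ℚ) (K : Type) [Field K] [NumberField K], kolyvagin N W K)
    (hnf : exists_isNewformOf) (hHL : HoffsteinLuo1997_exists_twist_L_one_ne_zero)
    (h37 : Literature.NumberTheory.EllipticCurves.GrossLMS1991.prop37_2_frobeniusCongruence) :
    ∀ (W : WeierstrassCurve ℚ) [W.IsElliptic] [W.IsGloballyMinimal] [NeZero (W.conductorNorm ℤ)],
    0 < W.Δ → ¬ W.HasCM → (∀ n : ℕ, W.HasSurjectiveModNGaloisRep ((2 ^ n : ℕ) : ℤ)) → Odd W.torsionOrder → Odd W.tamagawaProduct →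
    W.analyticRank = 1 → ¬ MeetsEgg W →
    ∀ (K : Type) [Field K] [NumberField K], IsImaginaryQuadratic K → DescAdmissible W (NumberField.discr K) →
      ∀ (Dt : ModularParametrizationData W (W.conductorNorm ℤ))
        (H : HeegnerDatum (W.conductorNorm ℤ) (NumberField.discr K)) (ι : K →+* ℂ)
        (P : (W.baseChange K).toAffine.Point),
        WeierstrassCurve.Affine.Point.map ι.toRatAlgHom P = heegnerPointComplex Dt H →
        ¬ (2 : ℤ) ∣ Dt.c →
          ¬ NotTwiceUpToTorsion W K P := by
  intro W _ _ _ hΔ hCM hsurj hT hc hr hegg K _ _ hK hDA Dt H ι P hP hc2 hnt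
  have hadm : DoorAdmissible W (NumberField.discr K) := ANg16.doorAdmissible_of_descAdmissible W hDA
  have hmin : transpCount W (NumberField.discr K) + 2 * identCount W (NumberField.discr K) = (if W.Δ < 0 then 1 else 0) :=
    minimal_of_descAdmissible_of_pos W hΔ hDA
  have hm0 : HasTwoDivisibilityUpToTorsion W K P 0 := hasTwoDivisibilityUpToTorsion_zero_of_notTwiceUpToTorsion W K P hnt
  have hHN : SatisfiesHeegnerHypothesis (W.conductorNorm ℤ) K := satisfiesHeegnerHypothesis_of_doorAdmissible W K hK hadm
  have hLt : (W.quadraticTwist (NumberField.discr K : ℚ)).entireLFunction 1 ≠ 0 :=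
    twist_entireLFunction_ne_zero_of_hasTwoDivisibilityUpToTorsion_zero hnf W hr K hK (hGZ _ W K) hHN Dt H ι P hP hm0
  have hodd : Odd Dt.c := Int.not_even_iff_odd.mp fun h => hc2 (even_iff_two_dvd.mp h)
  have hd0 : (NumberField.discr K : ℚ) ≠ 0 := by exact_mod_cast hK.discr_neg.ne
  haveI := W.isElliptic_quadraticTwist hd0
  obtain ⟨Cd, hCd⟩ := hasGlobalMinimalModel_rat_holds (W.quadraticTwist (NumberField.discr K : ℚ))
  haveI := hCd
  exact hegg (meetsEgg_at_bottomRung_of_print hGZ hKo hnf hHL h37 W hCM hsurj hT hc hr K hK hadm hLt Dt H ι P hP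
    (Cd • W.quadraticTwist (NumberField.discr K : ℚ)) Cd rfl hmin hodd hm0 hΔ)

end Summit.BirchSwinnertonDyer.BirchSwinnertonDyer.Theorems.RankOneAtTwoOneDoor

end
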